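import Literature.MathematicalPhysics.QuantumFieldTheory.Balaban1983to89.B5Eq129FreeResolventWeightedGradientRowOperator
import Literature.MathematicalPhysics.QuantumFieldTheory.Balaban1983to89.B5Eq129FreeResolventGradientRowSites
import Literature.MathematicalPhysics.QuantumFieldTheory.Balaban1983to89.B9Eq331PureGaugeResolventLetters
import Literature.MathematicalPhysics.QuantumFieldTheory.Balaban1983to89.B9Eq342GradientRowBootstrap

/-!
# `Balaban1983to89.B9Eq342GradientRowPureGauge` — T. Bałaban, *Propagators for lattice gauge theories in a background field*, Commun. Math. Phys. **99** (1985)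
# 389–434 [Balaban1985BackgroundPropagators] Thm 3.1 (3.42) p. 397 (second entry, the covariant-gradient row), p. 398 *«All these inequalities are invariant with
# respect to gauge transformations of U»*, (3.23) p. 394, (3.28)–(3.31) p. 395; [Balaban1984PropagatorsI] (1.29) p. 23: **THE COVARIANT GRADIENT ROW OF THE
# PURE-GAUGE RESOLVENT, EXPLICIT, AND STOREY J's `hT` BINDER INHABITED — for `U⁰ = 1^g` (`g` fibrewise isometric), `t > 0`, `m > 2d·t²(cosh a − 1)`, `a ≥ 0`,
# periods `N_ν ≥ 2`: every solution of `Δ_{U⁰}u + m u = h` with `‖h(y)‖ ≤ F·W_{x₀}(y)` (`W_{x₀}` the product-cosh weight centred at `x₀`) obeys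
# `‖(∇_{U⁰}u)(x,ν)‖ ≤ |t|·(B_ν·W_{x₀}(x+e_ν))·F` with the EXPLICIT `B_ν` of `B5Eq129FreeResolventWeightedGradientRowOperator`; hence the RESPONSE MAP
# `T (x,ν) h := (∇_{U⁰}((Δ_{U⁰} + m)⁻¹h))(x,ν)` satisfies the `hT` binder of `B9Eq342GradientRowBootstrap.norm_le_of_gradient_response_bootstrap` with `S = |t|`,
# `w = W_{x₀}`, `w′(x,ν) = B_ν·W_{x₀}(x+e_ν)`, and the bootstrap's closed form follows with the other binders displayed** — the junction of storey J's (K∇) chain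
# with its comparison resolvent (`g82/V26-NEXT.md` item 2), the tree form of the lineage's NOT-TO-FILE certificates J-K29 ∕ J-STOREYJ-2

statement-level skeleton of published theorems with citation tags; proofs where landed; nothing here is a claim about the Yang–Mills mass gap

CITATION HEADER (lean-in-tree rule).  Audit cell `pub-balaban`, sub-cell `t4`, BINDER row NE9; filed by NE9 crux-team LEAF PROVER 05
(`b2b-balaban-t4-ne9-formalise-leaf-05`, gen 83).  SOURCE READ first-hand in the held text layer [Balaban1985BackgroundPropagators]
(`paper:balaban1985-cmp99-background-propagators`, journal page = PDF page + 388): p. 397 Thm 3.1 (3.42), p. 398 (gauge invariance), p. 394 (3.23), p. 395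
(3.28)–(3.31); [Balaban1984PropagatorsI] p. 23 (1.29) (the free resolvent).  [folklore] COMPOSITION BY NAME of tree lemmas: (K24)
`B5Eq129FreeResolventWeightedGradientRowOperator.norm_apply_sub_le_of_resolvent_weighted` (the flat weighted gradient row on `Tor N`), (K27)
`B5Eq129FreeResolventGradientRowSites.gradRow_tsite_of_tor_shift` (transport to `TSite`), (K29) `B9Eq331PureGaugeResolventConjugation.norm_covDeriv_pureGauge_le_of_flat`
(pure gauge = gauged flat), (K33) `B9Eq331PureGaugeResolventLetters` (the resolvent map by `greenK`), (J-N) `B9Eq342GradientRowBootstrap` §4; the mathematics of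
the chain is t4-ne9-idea-1's (gens 111–141) and this lineage's gens 77–83 (credit in the parents).  Nothing printed is a hypothesis except `hAd`.

WHAT IS PROVED (sorry-free; 0 `def`; [folklore]).  `φ : W ≃ₗ[ℂ] 𝔸`, `W` finite-dimensional, `g : TSite d N → 𝔸ˣ` with `hAd`, `U⁰ := gaugeU g 1`; `t > 0`, `m`, `a`
with `2d·t²(cosh a − 1) < m`, `0 ≤ a`, `N_ν ≥ 2`; `x₀` a centre; `W_{x₀}(y) := Π_μ cosh(a·d_μ((x₀)_μ − y_μ))` (torus distance of representatives);
`B_ν := (1 + e^{−a})(1 + 2t∕(N_ν√m′))∕√(m′² + 4m′t²) + 2 sinh a∕(m − 2dt²(cosh a − 1))`, `m′ := m − 2(d−1)t²(cosh a − 1)` — all written out (no definition).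
* §1 **`norm_covDeriv_pureGauge_le_weighted`** — the gradient row of ANY solution `u` of `Δ_{U⁰}u + m u = h`.
* §2 **`norm_covDeriv_pureGauge_resolvent_le_weighted`** — the same for `u := (Δ_{U⁰} + m)⁻¹h` (`greenK`), in the `hT` shape
  `0 ≤ F → (∀ y, ‖h y‖ ≤ F·W_{x₀}(y)) → ‖T b h‖ ≤ |t|·F·(B_{b.2}·W_{x₀}(b₊))` with `h : TSite d N → W` a plain function (read into `SiteL2K` by `WL2.equiv.symm`).
* §3 **`norm_le_of_gradient_response_bootstrap_pureGauge`** — (J-N) §4 with THIS `T`: `hw′`, (REP) `hrep`, (DATA) `hg`, (PERT) `hV`, `|t|·ε₁ < 1` displayed ⊢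
  `‖D b‖ ≤ (|t|(Γ + ε₂N) + ε₀N)∕(1 − |t|ε₁)·(B_{b.2}·W_{x₀}(b₊))`.
* §4 **`norm_le_of_gradient_response_bootstrap_pureGauge_family`** — §3 for a BOND-DEPENDENT FAMILY `g_{b₀}` of comparison gauges (`T b₀` built on
  `U⁰_{b₀} = 1^{g_{b₀}}`; §2's letter is uniform in the gauge): the shape the (REP) instance needs, `U` being matched to a pure gauge per cube of (3.35).
* §5 **`direction_constant_lower_bound`** — `0 < β₀ := (1 + e^{−a})∕√(m′² + 4m′t²) ≤ B_ν` (ν-free; the assembly's currency letters `hβ`, `hβB`).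
HONEST SCOPE.  Plumbing at the comparison background only; (REP)∕(DATA)∕(PERT) are the consumer's (storey J's instances in the OWNER's vocabulary — not in the tree);
the weight is the product-cosh of the (K∇) chain (not print's `e^{−δ₀d}`); constants symbolic-explicit, not valued; nothing of Bałaban's Thm 3.1 asserted.  ONE junction
of ONE un-opened storey (J) of row L13.  NOT summit progress (cell pub-balaban: NE9 NOT PRINTED ∕ NOT PROVED; «NE9 ⇐ the named binders»; row WALLED ON A MODEL (O-NE9-1;
#5 UNRULED); spine PROVED 0∕9; rung (B)+1 finite T⁴ — NOT infinite volume, NOT mass gap, NOT BetaPertH, NOT Clay).  HONEST DEPENDENCY (cell line): continuum YM on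
T⁴ ⇐ BetaPertH ∧ nine spine estimates (0/9 proved); BetaPertH ⇐ (D1) ∧ (D4) ∧ CAP+tail; G-an2-4 gates asym, D1 and NE2/3/4.  NEW file; nothing modified.  Net new
unproved facts: 0.
-/

noncomputable section

open scoped BigOperators InnerProductSpace

namespace Literature.MathematicalPhysics.QuantumFieldTheory.Balaban1983to89.B9Eq342GradientRowPureGauge

open B4Sect5Torus (TSite)
open B9SectCLatticeCarrier (Bond bpos btgt shift unshift)
open B4TorusKernel.MultiPeriod (circAbs)
open B9Eq311L2Pairing (WL2)
open B9Eq310HessianOperator (adTransportW)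
open B11Eq103H1Complex (SiteL2K covLaplaceSiteK covDerivL2K greenK)
open B9Eq328GaugeAction (gaugeU AdW)
open B5Eq129FreeResolventWeightedGradientRowOperator (norm_apply_sub_le_of_resolvent_weighted)
open B5Eq129FreeResolventGradientRowSites (gradRow_tsite_of_tor_shift)
open B9Eq331PureGaugeResolventConjugation (norm_covDeriv_pureGauge_le_of_flat)
open B9Eq331PureGaugeResolventLetters (rePos_covLaplaceSiteK_pureGauge_add pureGauge_resolvent_eq)
open B9Eq342GradientRowBootstrap (norm_le_of_gradient_response_bootstrap)

variable {d : ℕ} {N : Fin d → ℕ} [∀ μ, NeZero (N μ)] {𝔸 : Type*} [Ring 𝔸] [Algebra ℂ 𝔸] {W : Type*} [NormedAddCommGroup W] [InnerProductSpace ℂ W]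
  (φ : W ≃ₗ[ℂ] 𝔸) {c₀ : ℝ} [Fact (0 < c₀)] (g : TSite d N → 𝔸ˣ)
  (hAd : ∀ (x : TSite d N) (v v' : W), ⟪AdW φ (g x) v, AdW φ (g x) v'⟫_ℂ = ⟪v, v'⟫_ℂ)

/-! ## §1 The covariant gradient row of any solution of `Δ_{U⁰}u + m u = h`, explicit -/

include hAd in
/-- **THE COVARIANT GRADIENT ROW OF THE PURE-GAUGE RESOLVENT, EXPLICIT**: `U⁰ = 1^g` (`hAd`), `t > 0`, `2d·t²(cosh a − 1) < m`, `0 ≤ a`, `N_ν ≥ 2`; every solution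
of `Δ_{U⁰}u + m u = h` with `‖h(y)‖ ≤ F·W_{x₀}(y)` obeys `‖(∇_{U⁰}u)(b)‖ ≤ |t|·((B_{b.2}·W_{x₀}(b₊))·F)` — (K29) §4 with `Hflat :=` (K27) ∘ (K24), one reassociation.
[folklore] [cite: Balaban1985BackgroundPropagators, Thm 3.1 (3.42) p.397, p.398, (3.31) p.395; Balaban1984PropagatorsI, (1.29) p.23] -/
theorem norm_covDeriv_pureGauge_le_weighted (t : ℝ) (ht : 0 < t) {m a : ℝ} (hm : 0 < m) (ha : 0 ≤ a) (hlam : 2 * (d : ℝ) * t ^ 2 * (Real.cosh a - 1) < m)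
    (hn : ∀ ν, 2 ≤ N ν) (x₀ : TSite d N) {u h : SiteL2K ℂ d N c₀ W}
    (hu : covLaplaceSiteK (t : ℂ) (adTransportW φ (gaugeU g 1)) (adTransportW φ fun b => (gaugeU g 1 b)⁻¹) u + (m : ℂ) • u = h)
    {F : ℝ} (hh : ∀ y, ‖WL2.equiv ℂ _ W h y‖ ≤ F * ∏ μ, Real.cosh (a * (circAbs (N μ) ((((x₀ μ : ℕ) : ZMod (N μ)) - ((y μ : ℕ) : ZMod (N μ))).val) : ℝ)))
    (b : Bond d N) :
    ‖WL2.equiv ℂ _ W (covDerivL2K ℂ c₀ (t : ℂ) (adTransportW φ (gaugeU g 1)) u) b‖ ≤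
      ‖(t : ℂ)‖ * ((((1 + Real.exp (-a)) * ((1 + 2 * t / (N b.2 * Real.sqrt (m - 2 * ((d : ℝ) - 1) * t ^ 2 * (Real.cosh a - 1)))) /
            Real.sqrt ((m - 2 * ((d : ℝ) - 1) * t ^ 2 * (Real.cosh a - 1)) ^ 2 + 4 * (m - 2 * ((d : ℝ) - 1) * t ^ 2 * (Real.cosh a - 1)) * t ^ 2)) +
          2 * Real.sinh a / (m - 2 * (d : ℝ) * t ^ 2 * (Real.cosh a - 1))) *
          ∏ μ, Real.cosh (a * (circAbs (N μ) ((((x₀ μ : ℕ) : ZMod (N μ)) - ((btgt b μ : ℕ) : ZMod (N μ))).val) : ℝ))) * F) := by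
  refine norm_covDeriv_pureGauge_le_of_flat φ g hAd
    (Ws := fun y => ∏ μ, Real.cosh (a * (circAbs (N μ) ((((x₀ μ : ℕ) : ZMod (N μ)) - ((y μ : ℕ) : ZMod (N μ))).val) : ℝ)))
    (Bb := fun b : Bond d N => ((1 + Real.exp (-a)) * ((1 + 2 * t / (N b.2 * Real.sqrt (m - 2 * ((d : ℝ) - 1) * t ^ 2 * (Real.cosh a - 1)))) /
            Real.sqrt ((m - 2 * ((d : ℝ) - 1) * t ^ 2 * (Real.cosh a - 1)) ^ 2 + 4 * (m - 2 * ((d : ℝ) - 1) * t ^ 2 * (Real.cosh a - 1)) * t ^ 2)) +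
          2 * Real.sinh a / (m - 2 * (d : ℝ) * t ^ 2 * (Real.cosh a - 1))) *
          ∏ μ, Real.cosh (a * (circAbs (N μ) ((((x₀ μ : ℕ) : ZMod (N μ)) - ((btgt b μ : ℕ) : ZMod (N μ))).val) : ℝ)))
    (fun V K F' hV hK b' => ?_) (t : ℂ) hu hh b
  have h := gradRow_tsite_of_tor_shift N
    (B := fun ν => (1 + Real.exp (-a)) * ((1 + 2 * t / (N ν * Real.sqrt (m - 2 * ((d : ℝ) - 1) * t ^ 2 * (Real.cosh a - 1)))) /
            Real.sqrt ((m - 2 * ((d : ℝ) - 1) * t ^ 2 * (Real.cosh a - 1)) ^ 2 + 4 * (m - 2 * ((d : ℝ) - 1) * t ^ 2 * (Real.cosh a - 1)) * t ^ 2)) +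
          2 * Real.sinh a / (m - 2 * (d : ℝ) * t ^ 2 * (Real.cosh a - 1)))
    (fun _ _ c _ hu' hg' ν x => norm_apply_sub_le_of_resolvent_weighted N t ht hm ha hlam hu' c hg' ν (hn ν) x) hV x₀ hK b'.2 b'.1
  rw [mul_right_comm] at h
  exact h

/-! ## §2 The response map of the resolvent `(Δ_{U⁰} + m)⁻¹` in storey J's `hT` shape -/

section Response

variable [FiniteDimensional ℂ W] (t : ℝ) (m a : ℝ) (hm : 0 < m) (x₀ : TSite d N)

/-- (local, syntactic — not declarations) the product-cosh weight centred at `x₀`, (K24)'s direction constant, and the resolvent map `R⁰ = (Δ_{U⁰} + m)⁻¹`. -/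
local notation "WT" => (fun y : TSite d N => ∏ μ, Real.cosh (a * (circAbs (N μ) (ZMod.val (((x₀ μ : ℕ) : ZMod (N μ)) - ((y μ : ℕ) : ZMod (N μ)))) : ℝ)))
local notation "BC" => (fun ν : Fin d => (1 + Real.exp (-a)) * ((1 + 2 * t / (N ν * Real.sqrt (m - 2 * ((d : ℝ) - 1) * t ^ 2 * (Real.cosh a - 1)))) /
      Real.sqrt ((m - 2 * ((d : ℝ) - 1) * t ^ 2 * (Real.cosh a - 1)) ^ 2 + 4 * (m - 2 * ((d : ℝ) - 1) * t ^ 2 * (Real.cosh a - 1)) * t ^ 2)) +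
    2 * Real.sinh a / (m - 2 * (d : ℝ) * t ^ 2 * (Real.cosh a - 1)))
local notation "R⁰" => (greenK (covLaplaceSiteK (c₀ := c₀) ((t : ℝ) : ℂ) (adTransportW φ (gaugeU g 1)) (adTransportW φ fun b => (gaugeU g 1 b)⁻¹) +
    ((m : ℝ) : ℂ) • LinearMap.id : SiteL2K ℂ d N c₀ W →ₗ[ℂ] SiteL2K ℂ d N c₀ W) (rePos_covLaplaceSiteK_pureGauge_add φ g hAd t hm))

/-- **STOREY J's `hT` BINDER INHABITED BY THE PURE-GAUGE RESPONSE MAP** `T b h := (∇_{U⁰}(R⁰h̃))(b)`, `R⁰ = (Δ_{U⁰} + m)⁻¹` (`greenK` at the re-positive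
`Δ_{U⁰} + m·1`, `B9Eq331PureGaugeResolventLetters`), `h̃` the plain function `h` read in `SiteL2K`: `0 ≤ F → (∀ y, ‖h y‖ ≤ F·W_{x₀}(y)) → ‖T b h‖ ≤ |t|·F·(B_{b.2}·W_{x₀}(b₊))`
— the shape of `B9Eq342GradientRowBootstrap.norm_le_of_gradient_response_bootstrap`'s `hT` with `S = |t|`, `w = W_{x₀}`, `w′ b = B_{b.2}·W_{x₀}(b₊)`. [folklore]
[cite: Balaban1985BackgroundPropagators, Thm 3.1 (3.42) p.397, (3.23) p.394; Balaban1984PropagatorsI, (1.29) p.23] -/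
theorem norm_covDeriv_pureGauge_resolvent_le_weighted (ht : 0 < t) (ha : 0 ≤ a) (hlam : 2 * (d : ℝ) * t ^ 2 * (Real.cosh a - 1) < m) (hn : ∀ ν, 2 ≤ N ν)
    (b : Bond d N) (h : TSite d N → W) (F : ℝ) (_hF : 0 ≤ F) (hh : ∀ y, ‖h y‖ ≤ F * WT y) :
    ‖WL2.equiv ℂ _ W (covDerivL2K ℂ c₀ (t : ℂ) (adTransportW φ (gaugeU g 1)) (R⁰ ((WL2.equiv ℂ (fun _ : TSite d N => c₀) W).symm h))) b‖ ≤
      ‖(t : ℂ)‖ * F * (BC b.2 * WT (btgt b)) := by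
  have hh' : ∀ y, ‖WL2.equiv ℂ _ W ((WL2.equiv ℂ (fun _ : TSite d N => c₀) W).symm h) y‖ ≤
      F * ∏ μ, Real.cosh (a * (circAbs (N μ) ((((x₀ μ : ℕ) : ZMod (N μ)) - ((y μ : ℕ) : ZMod (N μ))).val) : ℝ)) :=
    fun y => by rw [Equiv.apply_symm_apply]; exact hh y
  have h1 := norm_covDeriv_pureGauge_le_weighted φ g hAd t ht hm ha hlam hn x₀
    (pureGauge_resolvent_eq φ g hAd t m hm ((WL2.equiv ℂ (fun _ : TSite d N => c₀) W).symm h)) hh' b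
  exact h1.trans (le_of_eq (by ring))

/-! ## §3 The bootstrap's closed form with this response map, the other binders displayed -/

/-- **(J-N) §4 AT THE PURE-GAUGE RESPONSE MAP**: with `T b h := (∇_{U⁰}(R⁰h̃))(b)` (§2 supplies `hT`), the positivity of the bond weight `hw′`, the
representation `hrep`, the data bound `hg`, the perturbation letter `hV` and `|t|·ε₁ < 1` DISPLAYED:
`‖D b‖ ≤ (|t|(Γ + ε₂N) + ε₀N)∕(1 − |t|ε₁)·(B_{b.2}·W_{x₀}(b₊))`. [folklore] [cite: Balaban1985BackgroundPropagators, Thm 3.1 (3.42) p.397, p.398] -/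
theorem norm_le_of_gradient_response_bootstrap_pureGauge (ht : 0 < t) (ha : 0 ≤ a) (hlam : 2 * (d : ℝ) * t ^ 2 * (Real.cosh a - 1) < m)
    (hn : ∀ ν, 2 ≤ N ν) (D : Bond d N → W) (gdat Vdat : Bond d N → TSite d N → W) {ε₀ ε₁ ε₂ Γ Nv : ℝ} (hε₁ : 0 ≤ ε₁) (hε₂ : 0 ≤ ε₂) (hΓ : 0 ≤ Γ)
    (hNv : 0 ≤ Nv) (hw' : ∀ b : Bond d N, 0 < BC b.2 * WT (btgt b)) (hθ : ‖(t : ℂ)‖ * ε₁ < 1)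
    (hrep : ∀ b, ‖D b‖ ≤ ‖WL2.equiv ℂ _ W (covDerivL2K ℂ c₀ (t : ℂ) (adTransportW φ (gaugeU g 1))
        (R⁰ ((WL2.equiv ℂ (fun _ : TSite d N => c₀) W).symm fun y => gdat b y - Vdat b y))) b‖ + ε₀ * Nv * (BC b.2 * WT (btgt b)))
    (hg : ∀ b y, ‖gdat b y‖ ≤ Γ * WT y)
    (hV : ∀ M : ℝ, 0 ≤ M → (∀ b, ‖D b‖ ≤ M * (BC b.2 * WT (btgt b))) → ∀ b y, ‖Vdat b y‖ ≤ (ε₁ * M + ε₂ * Nv) * WT y) (b : Bond d N) :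
    ‖D b‖ ≤ (‖(t : ℂ)‖ * (Γ + ε₂ * Nv) + ε₀ * Nv) / (1 - ‖(t : ℂ)‖ * ε₁) * (BC b.2 * WT (btgt b)) :=
  norm_le_of_gradient_response_bootstrap D
    (fun b h => WL2.equiv ℂ _ W (covDerivL2K ℂ c₀ (t : ℂ) (adTransportW φ (gaugeU g 1)) (R⁰ ((WL2.equiv ℂ (fun _ : TSite d N => c₀) W).symm h))) b)
    gdat Vdat WT (fun b => BC b.2 * WT (btgt b)) hw' hε₁ hε₂ hΓ hNv hθ hrep
    (fun b h F hF hh => norm_covDeriv_pureGauge_resolvent_le_weighted φ g hAd t m a hm x₀ ht ha hlam hn b h F hF hh) hg hV b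

end Response

/-! ## §4 A bond-dependent family of comparison gauges (the (REP) instance matches `U` to a pure gauge per cube of (3.35)) -/

section Family

variable [FiniteDimensional ℂ W] (gf : Bond d N → TSite d N → 𝔸ˣ)
  (hAdf : ∀ (b₀ : Bond d N) (x : TSite d N) (v v' : W), ⟪AdW φ (gf b₀ x) v, AdW φ (gf b₀ x) v'⟫_ℂ = ⟪v, v'⟫_ℂ)
  (t : ℝ) (m a : ℝ) (hm : 0 < m) (x₀ : TSite d N)

/-- (local, syntactic) the weight, the direction constant, and the resolvent map `R⁰_{b₀} = (Δ_{U⁰_{b₀}} + m)⁻¹` of the `b₀`-th comparison gauge `U⁰_{b₀} = 1^{g_{b₀}}`. -/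
local notation "WT" => (fun y : TSite d N => ∏ μ, Real.cosh (a * (circAbs (N μ) (ZMod.val (((x₀ μ : ℕ) : ZMod (N μ)) - ((y μ : ℕ) : ZMod (N μ)))) : ℝ)))
local notation "BC" => (fun ν : Fin d => (1 + Real.exp (-a)) * ((1 + 2 * t / (N ν * Real.sqrt (m - 2 * ((d : ℝ) - 1) * t ^ 2 * (Real.cosh a - 1)))) /
      Real.sqrt ((m - 2 * ((d : ℝ) - 1) * t ^ 2 * (Real.cosh a - 1)) ^ 2 + 4 * (m - 2 * ((d : ℝ) - 1) * t ^ 2 * (Real.cosh a - 1)) * t ^ 2)) +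
    2 * Real.sinh a / (m - 2 * (d : ℝ) * t ^ 2 * (Real.cosh a - 1)))
local notation "R⁰[" b₀ "]" => (greenK (covLaplaceSiteK (c₀ := c₀) ((t : ℝ) : ℂ) (adTransportW φ (gaugeU (gf b₀) 1)) (adTransportW φ fun b => (gaugeU (gf b₀) 1 b)⁻¹) +
    ((m : ℝ) : ℂ) • LinearMap.id : SiteL2K ℂ d N c₀ W →ₗ[ℂ] SiteL2K ℂ d N c₀ W) (rePos_covLaplaceSiteK_pureGauge_add φ (gf b₀) (hAdf b₀) t hm))

/-- **(J-N) §4 AT A BOND-DEPENDENT FAMILY OF PURE-GAUGE RESPONSE MAPS**: comparison gauges `g_{b₀}` (`hAd` each), `U⁰_{b₀} := 1^{g_{b₀}}`,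
`T b₀ h := (∇_{U⁰_{b₀}}(R⁰_{b₀}h̃))(b₀)` — §2's letter is uniform in the gauge, so `hT` holds for the family with the SAME `S = |t|`, `w = W_{x₀}`,
`w′ b = B_{b.2}·W_{x₀}(b₊)`; with `hw′`, (REP) `hrep` (now against `T b₀` of the `b₀`-th gauge), (DATA) `hg`, (PERT) `hV`, `|t|·ε₁ < 1` DISPLAYED:
`‖D b‖ ≤ (|t|(Γ + ε₂N) + ε₀N)∕(1 − |t|ε₁)·(B_{b.2}·W_{x₀}(b₊))`.  (The representation of storey J matches `U` to a pure gauge on the cube of (3.35) around EACH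
output bond, hence a family.) [folklore] [cite: Balaban1985BackgroundPropagators, Thm 3.1 (3.42) p.397, (3.35) p.396, p.398] -/
theorem norm_le_of_gradient_response_bootstrap_pureGauge_family (ht : 0 < t) (ha : 0 ≤ a) (hlam : 2 * (d : ℝ) * t ^ 2 * (Real.cosh a - 1) < m)
    (hn : ∀ ν, 2 ≤ N ν) (D : Bond d N → W) (gdat Vdat : Bond d N → TSite d N → W) {ε₀ ε₁ ε₂ Γ Nv : ℝ} (hε₁ : 0 ≤ ε₁) (hε₂ : 0 ≤ ε₂) (hΓ : 0 ≤ Γ)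
    (hNv : 0 ≤ Nv) (hw' : ∀ b : Bond d N, 0 < BC b.2 * WT (btgt b)) (hθ : ‖(t : ℂ)‖ * ε₁ < 1)
    (hrep : ∀ b₀, ‖D b₀‖ ≤ ‖WL2.equiv ℂ _ W (covDerivL2K ℂ c₀ (t : ℂ) (adTransportW φ (gaugeU (gf b₀) 1))
        (R⁰[b₀] ((WL2.equiv ℂ (fun _ : TSite d N => c₀) W).symm fun y => gdat b₀ y - Vdat b₀ y))) b₀‖ + ε₀ * Nv * (BC b₀.2 * WT (btgt b₀)))
    (hg : ∀ b y, ‖gdat b y‖ ≤ Γ * WT y)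
    (hV : ∀ M : ℝ, 0 ≤ M → (∀ b, ‖D b‖ ≤ M * (BC b.2 * WT (btgt b))) → ∀ b y, ‖Vdat b y‖ ≤ (ε₁ * M + ε₂ * Nv) * WT y) (b : Bond d N) :
    ‖D b‖ ≤ (‖(t : ℂ)‖ * (Γ + ε₂ * Nv) + ε₀ * Nv) / (1 - ‖(t : ℂ)‖ * ε₁) * (BC b.2 * WT (btgt b)) :=
  norm_le_of_gradient_response_bootstrap D
    (fun b₀ h => WL2.equiv ℂ _ W (covDerivL2K ℂ c₀ (t : ℂ) (adTransportW φ (gaugeU (gf b₀) 1))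
      (R⁰[b₀] ((WL2.equiv ℂ (fun _ : TSite d N => c₀) W).symm h))) b₀)
    gdat Vdat WT (fun b => BC b.2 * WT (btgt b)) hw' hε₁ hε₂ hΓ hNv hθ hrep
    (fun b₀ h F hF hh => norm_covDeriv_pureGauge_resolvent_le_weighted φ (gf b₀) (hAdf b₀) t m a hm x₀ ht ha hlam hn b₀ h F hF hh) hg hV b

end Family

/-! ## §5 An explicit direction-free lower bound of the direction constant (the `0 < β ≤ B_ν` letters of the assembly) -/

omit [∀ μ, NeZero (N μ)] in
/-- **`β₀ := (1 + e^{−a})∕√(m′² + 4m′t²) ≤ B_ν` AND `0 < β₀`**, `m′ := m − 2(d−1)t²(cosh a − 1)`, under the window `2dt²(cosh a − 1) < m`, `0 < t`, `0 ≤ a`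
(drop the non-negative summands `2t∕(N_ν√m′)·(…)` and `2 sinh a∕(m − 2dt²(cosh a − 1))`; t4-ne9-idea-1 g147 L-g147-1) — discharges the currency letters `hβ`, `hβB` of
`B9Eq342GradientRowAssembly` §3 with a `ν`-free `β₀`. [folklore] [cite: Balaban1985BackgroundPropagators, Thm 3.1 (3.42) p.397; Balaban1984PropagatorsI, (1.29) p.23] -/
theorem direction_constant_lower_bound (t m a : ℝ) (ht : 0 < t) (ha : 0 ≤ a) (hlam : 2 * (d : ℝ) * t ^ 2 * (Real.cosh a - 1) < m) (ν : Fin d) :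
    0 < (1 + Real.exp (-a)) / Real.sqrt ((m - 2 * ((d : ℝ) - 1) * t ^ 2 * (Real.cosh a - 1)) ^ 2 + 4 * (m - 2 * ((d : ℝ) - 1) * t ^ 2 * (Real.cosh a - 1)) * t ^ 2) ∧
    (1 + Real.exp (-a)) / Real.sqrt ((m - 2 * ((d : ℝ) - 1) * t ^ 2 * (Real.cosh a - 1)) ^ 2 + 4 * (m - 2 * ((d : ℝ) - 1) * t ^ 2 * (Real.cosh a - 1)) * t ^ 2) ≤
      (1 + Real.exp (-a)) * ((1 + 2 * t / (N ν * Real.sqrt (m - 2 * ((d : ℝ) - 1) * t ^ 2 * (Real.cosh a - 1)))) /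
            Real.sqrt ((m - 2 * ((d : ℝ) - 1) * t ^ 2 * (Real.cosh a - 1)) ^ 2 + 4 * (m - 2 * ((d : ℝ) - 1) * t ^ 2 * (Real.cosh a - 1)) * t ^ 2)) +
          2 * Real.sinh a / (m - 2 * (d : ℝ) * t ^ 2 * (Real.cosh a - 1)) := by
  have hc : 0 ≤ Real.cosh a - 1 := by linarith [Real.one_le_cosh a]
  have hm'' : 0 < m - 2 * (d : ℝ) * t ^ 2 * (Real.cosh a - 1) := by linarith
  have hm' : 0 < m - 2 * ((d : ℝ) - 1) * t ^ 2 * (Real.cosh a - 1) := by nlinarith [sq_nonneg t]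
  set m' := m - 2 * ((d : ℝ) - 1) * t ^ 2 * (Real.cosh a - 1) with hm'def
  have hS : 0 < Real.sqrt (m' ^ 2 + 4 * m' * t ^ 2) := Real.sqrt_pos.mpr (by positivity)
  have he : 0 < 1 + Real.exp (-a) := by positivity
  refine ⟨div_pos he hS, ?_⟩
  have h1 : 1 ≤ 1 + 2 * t / (N ν * Real.sqrt m') := by
    have : 0 ≤ 2 * t / (N ν * Real.sqrt m') := div_nonneg (by linarith) (mul_nonneg (Nat.cast_nonneg _) (Real.sqrt_nonneg _))
    linarith
  have h2 : 0 ≤ 2 * Real.sinh a / (m - 2 * (d : ℝ) * t ^ 2 * (Real.cosh a - 1)) :=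
    div_nonneg (by linarith [Real.sinh_nonneg_iff.mpr ha]) hm''.le
  calc (1 + Real.exp (-a)) / Real.sqrt (m' ^ 2 + 4 * m' * t ^ 2)
      = (1 + Real.exp (-a)) * (1 / Real.sqrt (m' ^ 2 + 4 * m' * t ^ 2)) := by ring
    _ ≤ (1 + Real.exp (-a)) * ((1 + 2 * t / (N ν * Real.sqrt m')) / Real.sqrt (m' ^ 2 + 4 * m' * t ^ 2)) :=
        mul_le_mul_of_nonneg_left (div_le_div_of_nonneg_right h1 hS.le) he.le
    _ ≤ _ := le_add_of_nonneg_right h2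

end Literature.MathematicalPhysics.QuantumFieldTheory.Balaban1983to89.B9Eq342GradientRowPureGauge

end
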